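import Summits.CriticalPhenomena.Ising3D.Control2DOffDiagonal
import Mathlib.Analysis.SpecialFunctions.Pow.Real
import Mathlib.Analysis.SpecialFunctions.Sqrt
import Mathlib.Tactic.Linarith
import Mathlib.Tactic.Positivity
import Mathlib.Tactic.Ring
import HarnessLib

/-!
# Joint log-convexity of the typed four-point function on the open square (E.1ac's two bounds as one inequality)
(cell `pub-ising3x`, seat controls-1 gen 49; PAPER §6.2 / Appendix E.1ac — CONTROL-ONLY; companion of `Control2DOffDiagonal`)

HONEST FRAMING: lottery ticket; floor = tightest certified 3D Ising CFT bounds; no exact-solution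
claim without a proof. CONTROL-ONLY (`d = 2`, global `sl(2) × sl(2)` blocks, `Δ_σ = s` an INPUT, axiom set `A2D′`); nothing here is
about `d = 3`, no certificate, functional or number of the record is touched, and no new hypothesis, definition or named fact enters.

WHAT THIS FILE ADDS. `Control2DOffDiagonal` proved the geometric-mean lower bound `G(√(zz̄),√(zz̄)) ≤ G(z,z̄)` and the log-convexity
of the DIAGONAL function. Both are faces of ONE inequality: `G − 1` is (midpoint-)LOG-CONVEX JOINTLY in `(log z, log z̄)` on the whole open
square — it is the two-variable Laplace transform of the non-negative oriented-states measure —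

* `globalBlock_geom_sq_le_square` — for a unitary label and two points `(z,z̄)`, `(z′,z̄′)` of the square,
  `g(√(zz′), √(z̄z̄′))² ≤ g(z,z̄)·g(z′,z̄′)` (each product `k_h(z)k_h̄(z̄)` is jointly log-convex by E.1ac's `chiralBlock_geom_sq_le`, and a sum
  of two log-convex functions is log-convex: `(√(AA′) + √(BB′))² ≤ (A+B)(A′+B′)`, run as the free-parameter AM–GM);
* **`CrossingData.fourPoint_logConvex_square`** — `(G(√(zz′),√(z̄z̄′)) − 1)² ≤ (G(z,z̄) − 1)·(G(z′,z̄′) − 1)` for unitary data with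
  convergent expansion; `fourPoint_logConvex_square_free` for every unitary solution at `s > 0`;
* E.1ac's `fourPoint_diag_logConvex` (both points on the diagonal) and `fourPoint_geomMean_le` (the points `(z,z̄)`, `(z̄,z)`, equal `G`
  by `fourPoint_swap`) are its two specialisations — landed there, not restated here.

NOT claimed: convexity with arbitrary weights (only the midpoint/geometric-mean form — full convexity would follow with E.1p's
continuity, not run here), hence no monotonicity along hyperbolas; strictness; complex `z`; anything of the record. References (CONTEXT,
not inputs): [cite: DolanOsborn2004, §3]; [cite: RattazziEtAl2008, §3]. Tree inputs by name: `chiralBlock_geom_sq_le`,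
`two_mul_le_param_of_sq_le`, `sq_le_mul_of_forall_param`, `sqrt_mul_mem_Ioo`, `fourPoint_swap`, `globalBlock_nonneg`, `chiralBlock_nonneg`,
`opeConvergent_free` (`Control2DOffDiagonal` and its imports). Mathlib: `hasSum_le`, `HasSum.mul_left`, `HasSum.div_const`.
-/

namespace Summit.CriticalPhenomena.Ising3D.Control2D

open Set
open Literature.MathematicalPhysics.QuantumFieldTheory.ConformalBootstrap3D

/-! ### The block is jointly log-convex in `(log z, log z̄)` -/

/-- One chiral product is jointly log-convex: `(k_{h₁}(√(zz′))·k_{h₂}(√(z̄z̄′)))² ≤ (k_{h₁}(z)k_{h₂}(z̄))·(k_{h₁}(z′)k_{h₂}(z̄′))`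
(E.1ac's `chiralBlock_geom_sq_le` in each variable). [folklore] -/
theorem chiralPair_geom_sq_le {h₁ h₂ : ℝ} (hh₁ : 0 ≤ h₁) (hh₂ : 0 ≤ h₂) {z zb z' zb' : ℝ} (hz : z ∈ Ioo (0 : ℝ) 1)
    (hzb : zb ∈ Ioo (0 : ℝ) 1) (hz' : z' ∈ Ioo (0 : ℝ) 1) (hzb' : zb' ∈ Ioo (0 : ℝ) 1) :
    (chiralBlock h₁ (Real.sqrt (z * z')) * chiralBlock h₂ (Real.sqrt (zb * zb'))) ^ 2 ≤
      (chiralBlock h₁ z * chiralBlock h₂ zb) * (chiralBlock h₁ z' * chiralBlock h₂ zb') := by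
  have h1 := chiralBlock_geom_sq_le hh₁ hz hz'
  have h2 := chiralBlock_geom_sq_le hh₂ hzb hzb'
  have hn : 0 ≤ chiralBlock h₁ z * chiralBlock h₁ z' := mul_nonneg (chiralBlock_nonneg hh₁ hz) (chiralBlock_nonneg hh₁ hz')
  calc (chiralBlock h₁ (Real.sqrt (z * z')) * chiralBlock h₂ (Real.sqrt (zb * zb'))) ^ 2
      = chiralBlock h₁ (Real.sqrt (z * z')) ^ 2 * chiralBlock h₂ (Real.sqrt (zb * zb')) ^ 2 := by ring
    _ ≤ (chiralBlock h₁ z * chiralBlock h₁ z') * (chiralBlock h₂ zb * chiralBlock h₂ zb') :=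
        mul_le_mul h1 h2 (sq_nonneg _) hn
    _ = _ := by ring

/-- **The block is jointly log-convex**: for a unitary label `ℓ ≤ Δ` and two points of the open square,
`g_{Δ,ℓ}(√(zz′), √(z̄z̄′))² ≤ g_{Δ,ℓ}(z,z̄)·g_{Δ,ℓ}(z′,z̄′)` — with `A = k_h(z)k_h̄(z̄)`, `B = k_h̄(z)k_h(z̄)` and primes at the second
point, `g(mid) ≤ √(AA′) + √(BB′) ≤ √((A+B)(A′+B′))`, run as `2·g(mid) ≤ t·g + g′/t` for every `t > 0`. [folklore] -/
theorem globalBlock_geom_sq_le_square {Δ : ℝ} {ℓ : ℕ} (hΔ : (ℓ : ℝ) ≤ Δ) {z zb z' zb' : ℝ} (hz : z ∈ Ioo (0 : ℝ) 1)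
    (hzb : zb ∈ Ioo (0 : ℝ) 1) (hz' : z' ∈ Ioo (0 : ℝ) 1) (hzb' : zb' ∈ Ioo (0 : ℝ) 1) :
    globalBlock Δ ℓ (Real.sqrt (z * z')) (Real.sqrt (zb * zb')) ^ 2 ≤ globalBlock Δ ℓ z zb * globalBlock Δ ℓ z' zb' := by
  have hℓ : (0 : ℝ) ≤ ℓ := Nat.cast_nonneg ℓ
  have hh₁ : 0 ≤ (Δ + ℓ) / 2 := by linarith
  have hh₂ : 0 ≤ (Δ - ℓ) / 2 := by linarith
  have hm := sqrt_mul_mem_Ioo hz hz'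
  have hmb := sqrt_mul_mem_Ioo hzb hzb'
  -- the two oriented halves `A = k₁(z)k₂(z̄)`, `B = k₂(z)k₁(z̄)` at the three points
  have hA := chiralPair_geom_sq_le hh₁ hh₂ hz hzb hz' hzb'
  have hB := chiralPair_geom_sq_le hh₂ hh₁ hz hzb hz' hzb'
  have nA : 0 ≤ chiralBlock ((Δ + ℓ) / 2) z * chiralBlock ((Δ - ℓ) / 2) zb :=
    mul_nonneg (chiralBlock_nonneg hh₁ hz) (chiralBlock_nonneg hh₂ hzb)
  have nA' : 0 ≤ chiralBlock ((Δ + ℓ) / 2) z' * chiralBlock ((Δ - ℓ) / 2) zb' :=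
    mul_nonneg (chiralBlock_nonneg hh₁ hz') (chiralBlock_nonneg hh₂ hzb')
  have nB : 0 ≤ chiralBlock ((Δ - ℓ) / 2) z * chiralBlock ((Δ + ℓ) / 2) zb :=
    mul_nonneg (chiralBlock_nonneg hh₂ hz) (chiralBlock_nonneg hh₁ hzb)
  have nB' : 0 ≤ chiralBlock ((Δ - ℓ) / 2) z' * chiralBlock ((Δ + ℓ) / 2) zb' :=
    mul_nonneg (chiralBlock_nonneg hh₂ hz') (chiralBlock_nonneg hh₁ hzb')
  have nAm : 0 ≤ chiralBlock ((Δ + ℓ) / 2) (Real.sqrt (z * z')) * chiralBlock ((Δ - ℓ) / 2) (Real.sqrt (zb * zb')) :=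
    mul_nonneg (chiralBlock_nonneg hh₁ hm) (chiralBlock_nonneg hh₂ hmb)
  have nBm : 0 ≤ chiralBlock ((Δ - ℓ) / 2) (Real.sqrt (z * z')) * chiralBlock ((Δ + ℓ) / 2) (Real.sqrt (zb * zb')) :=
    mul_nonneg (chiralBlock_nonneg hh₂ hm) (chiralBlock_nonneg hh₁ hmb)
  refine sq_le_mul_of_forall_param (globalBlock_nonneg hΔ hz hzb) (globalBlock_nonneg hΔ hz' hzb')
    (globalBlock_nonneg hΔ hm hmb) fun t ht => ?_
  have h1 := two_mul_le_param_of_sq_le nA nA' nAm hA ht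
  have h2 := two_mul_le_param_of_sq_le nB nB' nBm hB ht
  have h12 := add_le_add h1 h2
  have e : t * globalBlock Δ ℓ z zb + globalBlock Δ ℓ z' zb' / t =
      (t * (chiralBlock ((Δ + ℓ) / 2) z * chiralBlock ((Δ - ℓ) / 2) zb) +
          chiralBlock ((Δ + ℓ) / 2) z' * chiralBlock ((Δ - ℓ) / 2) zb' / t) +
        (t * (chiralBlock ((Δ - ℓ) / 2) z * chiralBlock ((Δ + ℓ) / 2) zb) +
          chiralBlock ((Δ - ℓ) / 2) z' * chiralBlock ((Δ + ℓ) / 2) zb' / t) := by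
    unfold globalBlock; ring
  rw [e]
  unfold globalBlock
  linarith

namespace CrossingData

variable {D : CrossingData} {s : ℝ}

/-! ### The typed four-point function is jointly log-convex on the square -/

/-- **Joint log-convexity of `G − 1` on the open square**: for unitary data with convergent expansion and two points `(z,z̄)`,
`(z′,z̄′)` of the square, `(G(√(zz′),√(z̄z̄′)) − 1)² ≤ (G(z,z̄) − 1)·(G(z′,z̄′) − 1)` — `G − 1 = Σ_i p_i g_i` is the two-variable Laplace
transform (in `log(1/z)`, `log(1/z̄)`) of a non-negative measure (for every `t > 0`, termwise `2 p_i g_i(mid) ≤ t p_i g_i + p_i g_i′/t`,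
summed, then `sq_le_mul_of_forall_param`). [folklore] -/
theorem fourPoint_logConvex_square (hU : D.IsUnitary) (hconv : D.OpeConvergent) {z zb z' zb' : ℝ} (hz : z ∈ Ioo (0 : ℝ) 1)
    (hzb : zb ∈ Ioo (0 : ℝ) 1) (hz' : z' ∈ Ioo (0 : ℝ) 1) (hzb' : zb' ∈ Ioo (0 : ℝ) 1) :
    (D.fourPoint (Real.sqrt (z * z')) (Real.sqrt (zb * zb')) - 1) ^ 2 ≤
      (D.fourPoint z zb - 1) * (D.fourPoint z' zb' - 1) := by
  have hm := sqrt_mul_mem_Ioo hz hz'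
  have hmb := sqrt_mul_mem_Ioo hzb hzb'
  have hG : ∀ u v : ℝ, D.fourPoint u v - 1 = ∑' i, D.p i * globalBlock (D.Δ i) (D.spin i) u v := fun u v => by
    unfold fourPoint; ring
  have hnn : ∀ {u v : ℝ}, u ∈ Ioo (0 : ℝ) 1 → v ∈ Ioo (0 : ℝ) 1 → 0 ≤ D.fourPoint u v - 1 := fun hu hv => by
    rw [hG]; exact tsum_nonneg fun i => mul_nonneg (hU i).2.2 (globalBlock_nonneg (hU i).2.1 hu hv)
  refine sq_le_mul_of_forall_param (hnn hz hzb) (hnn hz' hzb') (hnn hm hmb) fun t ht => ?_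
  have hle : ∀ i, 2 * (D.p i * globalBlock (D.Δ i) (D.spin i) (Real.sqrt (z * z')) (Real.sqrt (zb * zb'))) ≤
      t * (D.p i * globalBlock (D.Δ i) (D.spin i) z zb) + D.p i * globalBlock (D.Δ i) (D.spin i) z' zb' / t := by
    intro i
    have hp := (hU i).2.2
    have h := two_mul_le_param_of_sq_le (globalBlock_nonneg (hU i).2.1 hz hzb) (globalBlock_nonneg (hU i).2.1 hz' hzb')
      (globalBlock_nonneg (hU i).2.1 hm hmb) (globalBlock_geom_sq_le_square (hU i).2.1 hz hzb hz' hzb') ht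
    have h' := mul_le_mul_of_nonneg_left h hp
    have e : D.p i * (t * globalBlock (D.Δ i) (D.spin i) z zb + globalBlock (D.Δ i) (D.spin i) z' zb' / t) =
        t * (D.p i * globalBlock (D.Δ i) (D.spin i) z zb) + D.p i * globalBlock (D.Δ i) (D.spin i) z' zb' / t := by
      ring
    linarith
  have h := hasSum_le hle ((hconv _ _ hm hmb).hasSum.mul_left 2)
    (((hconv z zb hz hzb).hasSum.mul_left t).add ((hconv z' zb' hz' hzb').hasSum.div_const t))
  rw [hG, hG, hG]
  exact h

/-- The same for every unitary solution of the typed sum rule at `s > 0` (E.1m's `opeConvergent_free`). [folklore] -/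
theorem fourPoint_logConvex_square_free (hU : D.IsUnitary) (hC : D.SatisfiesCrossing s) (hs : 0 < s) {z zb z' zb' : ℝ}
    (hz : z ∈ Ioo (0 : ℝ) 1) (hzb : zb ∈ Ioo (0 : ℝ) 1) (hz' : z' ∈ Ioo (0 : ℝ) 1) (hzb' : zb' ∈ Ioo (0 : ℝ) 1) :
    (D.fourPoint (Real.sqrt (z * z')) (Real.sqrt (zb * zb')) - 1) ^ 2 ≤
      (D.fourPoint z zb - 1) * (D.fourPoint z' zb' - 1) :=
  fourPoint_logConvex_square hU (opeConvergent_free hU hC hs) hz hzb hz' hzb'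

/-! E.1ac's two datum-level statements are the two natural specialisations of `fourPoint_logConvex_square` — both points on the
diagonal (`fourPoint_diag_logConvex`), and the pair `(z,z̄)`, `(z̄,z)` whose geometric midpoint is the diagonal point `(√(zz̄),√(zz̄))` and
whose values of `G` agree by `fourPoint_swap`, so that `(G(mid) − 1)² ≤ (G(z,z̄) − 1)²` is `fourPoint_geomMean_le`. They are landed in
`Control2DOffDiagonal` and are not restated here (the gate's `dedup.landed`). -/

end CrossingData

end Summit.CriticalPhenomena.Ising3D.Control2D
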